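import Literature.Geometry.Lorentzian.AdiabaticTracking
import Summits.FinalStateConjecture.FinalStateConjecture.Theorems.RenormalisedDriftDriftCapturePinnedOfSettle
import HarnessLib

/-!
# FREEZE bookkeeping for crux `DriftCapture` (stmt-FinalStateConjecture-17391), line `birth` v6:
# one sharpening chain with Cauchy labels ⇒ its labels converge to a point of the moduli space

The registered stub `stub_pinnedOfCauchyChain` of the skeleton
`Summits/FinalStateConjecture/FinalStateConjecture/Cruxes/DriftCapture/Lines/birth.lean` (v6) is the formal half of FREEZE
in the SHARPENING-CHAIN seam: the physics half `stub_sharpTrackingChain` delivers ONE chain `n ↦ cₙ` of `εₙ`-approximate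
`N`-Kerr configurations on chart-time windows `[0, 1]` with accuracies `εₙ → 0`, near-zone radii `Rₙ → ∞`, labels in the
moduli box, chained start slabs, exhaustion of every compact past, the region `O` pinned as `J⁺(ι X) ∩ I⁻(⋃ windows)` and
covered, whose labels `(Mᵢ⁽ⁿ⁾, aᵢ⁽ⁿ⁾, Λᵢ⁽ⁿ⁾)` form a CAUCHY sequence (for every `δ > 0`, from some window on, any two windows'
labels agree within `δ`). This file proves that then there is ONE label `(M, a, Λ)` — `Mⱼ ∈ [m₀, m₀⁻¹]`, `|aⱼ| ≤ χ Mⱼ`,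
`Λⱼ ∈ O(1,3)` — such that the same chain is EVENTUALLY `δ`-PINNED at `(M, a, Λ)` for every `δ > 0`.

Proof: the label vectors live in the complete space `(Fin N → ℝ) × (Fin N → ℝ) × (Fin N → (E4 →L[ℝ] E4))` (sup norms), are
Cauchy, hence converge; eventually they lie in the closed label set of `isClosed_labelSet` (box × `η`-isometries of norm `≤ ‖p‖ + 1`,
`p` the limit), so the limit is in the box and its boost components are `η`-isometries, i.e. Lorentz transformations
(`exists_lorentzGroup_coe_eq`, both from `Theorems/RenormalisedDriftDriftCapturePinnedOfSettle.lean`, p155010).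

No definitions, no named facts. References: Klainerman, C. R. Mécanique 353 (2025), §2.3; O'Neill 1983, Ch. 9, pp. 233–236.
-/

-- the doubled `FinalStateConjecture.FinalStateConjecture` path component trips dupNamespace
set_option linter.dupNamespace false

noncomputable section

namespace Summit.FinalStateConjecture.FinalStateConjecture.Theorems.RenormalisedDrift.DriftCapture

open Set Filter Topology
open scoped Manifold ContDiff ENNReal
open Literature.Geometry.Lorentzian

/-- **FREEZE bookkeeping (sharpening-chain seam) — Cauchy labels along one chain converge to a point of the moduli
space.** The registered stub `stub_pinnedOfCauchyChain` of crux `DriftCapture`, line `birth` v6 (statement verbatim): for any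
vacuum Cauchy development `𝒟`, hole number `N` and bounds `m₀`, `χ`, a chain of `εₙ`-approximate `N`-Kerr configurations on
windows `[0, 1]` with `εₙ → 0`, `Rₙ → ∞`, labels in the box, chaining, exhaustion, pinned and covered region, and CAUCHY labels,
yields ONE point `(M, a, Λ)` of the moduli space and such a chain (the same one) which is eventually `δ`-pinned at `(M, a, Λ)`
for every `δ > 0`. Completeness of the finite-dimensional label space, closedness of the label box and of `O(1,3)`.
Klainerman, C. R. Mécanique 353 (2025), §2.3. [folklore] -/
theorem stub_pinnedOfCauchyChain : ∀ {X : Type} [TopologicalSpace X] [ChartedSpace E3 X] [IsManifold (𝓡 3) ((⊤ : ℕ∞) : WithTop ℕ∞) X] [ConnectedSpace X] {D : InitialDataSet (𝓡 3) X} (𝒟 : VacuumCauchyDevelopment D) (N : ℕ) (m₀ χ : ℝ), (∃ (ε : ℕ → ENNReal) (R : ℕ → ℝ) (O : Set 𝒟.carrier) (c : ∀ n : ℕ, ApproximateKerrConfiguration 𝒟.toSpacetime O 2 (ε n) 0 1 (R n)), Tendsto ε atTop (𝓝 0) ∧ Tendsto R atTop atTop ∧ (∀ n, (c n).N = N) ∧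 (∀ n (i : Fin (c n).N), m₀ ≤ (c n).mass i ∧ (c n).mass i ≤ m₀⁻¹ ∧ |(c n).spin i| ≤ χ * (c n).mass i) ∧ (∀ n, (c (n + 1)).certifiedSlab 0 ⊆ (c n).windowImage) ∧ (∀ K : Set 𝒟.carrier, IsCompact K → ∃ n₀ : ℕ, ∀ n, n₀ ≤ n → Disjoint (c n).windowImage (𝒟.metric.causalPast 𝒟.timeOrientation K)) ∧ O = 𝒟.toCauchyDevelopment.exteriorOf (⋃ n, (c n).windowImage) ∧ O ⊆ 𝒟.metric.causalPast 𝒟.timeOrientation ((c 0).certifiedSlab 0) ∪ ⋃ n, (c n).windowImage ∧ ∀ δ : ℝ, 0 < δ → ∃ n₀ : ℕ, ∀ n n' : ℕ, n₀ ≤ n → n₀ ≤ n' → ∀ (i : Fin (c n).N) (i' : Fin (c n').N), (i : ℕ) = (i' : ℕ) → |(c n).mass i - (c n').mass i'| ≤ δ ∧ |(c n).spin i - (c n').spin i'| ≤ δ ∧ ‖((((c n).motion i).1 : E4 ≃L[ℝ] E4) : E4 →L[ℝ] E4) - ((((c n').motion i').1 : E4 ≃L[ℝ] E4) : E4 →L[ℝ]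 E4)‖ ≤ δ) → ∃ (M a : Fin N → ℝ) (Λ : Fin N → lorentzGroup), (∀ j, m₀ ≤ M j ∧ M j ≤ m₀⁻¹ ∧ |a j| ≤ χ * M j) ∧ ∃ (ε : ℕ → ENNReal) (R : ℕ → ℝ) (O : Set 𝒟.carrier) (c : ∀ n : ℕ, ApproximateKerrConfiguration 𝒟.toSpacetime O 2 (ε n) 0 1 (R n)), Tendsto ε atTop (𝓝 0) ∧ Tendsto R atTop atTop ∧ (∀ n, (c n).N = N) ∧ (∀ n (i : Fin (c n).N), m₀ ≤ (c n).mass i ∧ (c n).mass i ≤ m₀⁻¹ ∧ |(c n).spin i| ≤ χ * (c n).mass i) ∧ (∀ n, (c (n + 1)).certifiedSlab 0 ⊆ (c n).windowImage) ∧ (∀ K : Set 𝒟.carrier, IsCompact K → ∃ n₀ : ℕ, ∀ n, n₀ ≤ n → Disjoint (c n).windowImage (𝒟.metric.causalPast 𝒟.timeOrientation K)) ∧ O = 𝒟.toCauchyDevelopment.exteriorOf (⋃ n, (c n).windowImage) ∧ O ⊆ 𝒟.metric.causalPast 𝒟.timeOrientation ((c 0).certifiedSlab 0) ∪ ⋃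 n, (c n).windowImage ∧ ∀ δ : ℝ, 0 < δ → ∃ n₀ : ℕ, ∀ n, n₀ ≤ n → ∀ (i : Fin (c n).N) (j : Fin N), (i : ℕ) = (j : ℕ) → |(c n).mass i - M j| ≤ δ ∧ |(c n).spin i - a j| ≤ δ ∧ ‖((((c n).motion i).1 : E4 ≃L[ℝ] E4) : E4 →L[ℝ] E4) - (((Λ j : E4 ≃L[ℝ] E4)) : E4 →L[ℝ] E4)‖ ≤ δ := by
  intro X _ _ _ _ D 𝒟 N m₀ χ h
  obtain ⟨ε, R, O, c, hε, hRt, hN, hM, hch, hex, hO, hcov, hcauchy⟩ := h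
  -- the label vectors of the windows
  let q : ℕ → (Fin N → ℝ) × (Fin N → ℝ) × (Fin N → (E4 →L[ℝ] E4)) := fun n ↦
    (fun j ↦ (c n).mass (Fin.cast (hN n).symm j), fun j ↦ (c n).spin (Fin.cast (hN n).symm j),
      fun j ↦ ((((c n).motion (Fin.cast (hN n).symm j)).1 : E4 ≃L[ℝ] E4) : E4 →L[ℝ] E4))
  -- Step 1: they form a Cauchy sequence (sup norms: componentwise `≤ δ/2 < δ`)
  have hq : CauchySeq q := by
    refine Metric.cauchySeq_iff.2 fun δ hδ ↦ ?_
    obtain ⟨n₀, hn₀⟩ := hcauchy (δ / 2) (half_pos hδ)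
    refine ⟨n₀, fun n hn n' hn' ↦ ?_⟩
    rw [dist_eq_norm]
    refine lt_of_le_of_lt ?_ (half_lt_self hδ)
    have hδ2 : 0 ≤ δ / 2 := (half_pos hδ).le
    have hcomp : ∀ j : Fin N, |(c n).mass (Fin.cast (hN n).symm j) - (c n').mass (Fin.cast (hN n').symm j)| ≤ δ / 2 ∧
        |(c n).spin (Fin.cast (hN n).symm j) - (c n').spin (Fin.cast (hN n').symm j)| ≤ δ / 2 ∧
        ‖((((c n).motion (Fin.cast (hN n).symm j)).1 : E4 ≃L[ℝ] E4) : E4 →L[ℝ] E4) -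
          ((((c n').motion (Fin.cast (hN n').symm j)).1 : E4 ≃L[ℝ] E4) : E4 →L[ℝ] E4)‖ ≤ δ / 2 :=
      fun j ↦ hn₀ n n' hn hn' _ _ rfl
    rw [Prod.norm_def, Prod.norm_def]
    refine max_le ((pi_norm_le_iff_of_nonneg hδ2).2 fun j ↦ ?_)
      (max_le ((pi_norm_le_iff_of_nonneg hδ2).2 fun j ↦ ?_) ((pi_norm_le_iff_of_nonneg hδ2).2 fun j ↦ ?_))
    · rw [Prod.fst_sub, Pi.sub_apply, Real.norm_eq_abs]; exact (hcomp j).1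
    · rw [Prod.snd_sub, Prod.fst_sub, Pi.sub_apply, Real.norm_eq_abs]; exact (hcomp j).2.1
    · rw [Prod.snd_sub, Prod.snd_sub, Pi.sub_apply]; exact (hcomp j).2.2
  -- Step 2: the limit, and the closed label set it lies in
  obtain ⟨p, hp⟩ := cauchySeq_tendsto_of_complete hq
  set C : ℝ := ‖p‖ + 1 with hC
  have hmem : p ∈ {x : (Fin N → ℝ) × (Fin N → ℝ) × (Fin N → (E4 →L[ℝ] E4)) |
      (∀ j, m₀ ≤ x.1 j ∧ x.1 j ≤ m₀⁻¹ ∧ |x.2.1 j| ≤ χ * x.1 j) ∧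
      ∀ j, (∀ v w, Minkowski.bilin (x.2.2 j v) (x.2.2 j w) = Minkowski.bilin v w) ∧ ‖x.2.2 j‖ ≤ C} := by
    refine (isClosed_labelSet N m₀ χ C).mem_of_tendsto hp ?_
    have hev : ∀ᶠ n in atTop, dist (q n) p < 1 := Metric.tendsto_atTop.1 hp 1 one_pos |>.elim
      fun n₁ hn₁ ↦ eventually_atTop.2 ⟨n₁, hn₁⟩
    filter_upwards [hev] with n hn
    refine ⟨fun j ↦ hM n _, fun j ↦ ⟨fun v w ↦ ((c n).motion (Fin.cast (hN n).symm j)).1.2 v w, ?_⟩⟩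
    calc ‖(q n).2.2 j‖ ≤ ‖(q n).2.2‖ := norm_le_pi_norm _ j
      _ ≤ ‖q n‖ := (norm_snd_le (q n).2).trans (norm_snd_le (q n))
      _ ≤ C := norm_le_of_mem_closedBall (Metric.mem_closedBall.2 hn.le)
  obtain ⟨hbox, hlor⟩ := hmem
  choose Λ hΛ using fun j ↦ exists_lorentzGroup_coe_eq (p.2.2 j) (hlor j).1
  refine ⟨p.1, p.2.1, Λ, hbox, ε, R, O, c, hε, hRt, hN, hM, hch, hex, hO, hcov, fun δ hδ ↦ ?_⟩
  -- Step 3: eventual pinning at the limit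
  obtain ⟨n₀, hn₀⟩ := Metric.tendsto_atTop.1 hp δ hδ
  refine ⟨n₀, fun n hn i j hij ↦ ?_⟩
  have hdist : ‖q n - p‖ ≤ δ := by rw [← dist_eq_norm]; exact (hn₀ n hn).le
  have hi : i = Fin.cast (hN n).symm j := Fin.ext hij
  subst hi
  refine ⟨?_, ?_, ?_⟩
  · have := (norm_le_pi_norm ((q n).1 - p.1) j).trans ((norm_fst_le (q n - p)).trans hdist)
    rwa [Pi.sub_apply, Real.norm_eq_abs] at this
  · have := (norm_le_pi_norm ((q n).2.1 - p.2.1) j).trans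
      ((norm_fst_le (q n - p).2).trans ((norm_snd_le (q n - p)).trans hdist))
    rwa [Pi.sub_apply, Real.norm_eq_abs] at this
  · have := (norm_le_pi_norm ((q n).2.2 - p.2.2) j).trans
      ((norm_snd_le (q n - p).2).trans ((norm_snd_le (q n - p)).trans hdist))
    rwa [Pi.sub_apply, ← hΛ j] at this

end Summit.FinalStateConjecture.FinalStateConjecture.Theorems.RenormalisedDrift.DriftCapture

end
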